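import Summits.BirchSwinnertonDyer.BirchSwinnertonDyer.Theorems.EisensteinDepletionAtTwoStarAdmissibleData
import Literature.NumberTheory.EllipticCurves.NoConductorOne
import Literature.NumberTheory.EllipticCurves.PAdicLFunction
import Literature.NumberTheory.DiophantineGeometry.ConductorExponentLeTwoProofs
import HarnessLib

/-!
# Route `EisensteinDepletionAtTwo`, crux E1M `DepletedLambdaLawAtTwoMod` (item stmt-BirchSwinnertonDyer-20341),
# line `star` — admissible stabilisation data at the CONDUCTOR of a habitat curve: exactly «not prime ∧ ord₃ N ≤ 2»

Cell `bsd-rank2`, seat `bsd-rank2-eng-2` GEN 9. THEOREMS ONLY; no `sorry`, no named fact. HONEST FRAMING: conductor bookkeeping;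
nothing reads an analytic rank; (★-SymbC)/(★)/E1M are NOT proved; BSD is not proved by any of this (PARTITION D-0054: none).

For a globally minimal elliptic `W/ℚ` with good reduction at `2` (in particular every curve of the Prop-5.14 habitat of
line `star`), the `∃ β, IsAdmissibleStabData N_W β`-clause of the research stub (★-SymbC) holds iff `N_W` is not prime
and `ord₃ N_W ≤ 2`:

* `N_W ≠ 0` — `WeierstrassCurve.conductorNorm_pos_holds` (tree theorem);
* `N_W ≠ 1` — `WeierstrassCurve.conductorNorm_ne_one` (Tate: no curve of conductor `1`; PROVED, `NoConductorOne.lean`);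
* `ord_ℓ N_W ≤ 2` for `ℓ ≥ 5` — `conductorExponent_le_two_of_five_le_natGenerator_holds` (tree theorem), `ℓ = 2`: `2 ∤ N_W`
  by good reduction (`factorization_conductorNorm_holds` + `conductorExponent_eq_zero_iff_holds`);
* the one remaining PRINT input is `ord₃ N_W ≤ 2` (Ogg–Saito: for a curve with a rational `2`-torsion point the wild
  exponent at `3` vanishes — the route's `hOgg`-type input), displayed as a hypothesis.

So the honest level hypothesis of `stub_starSymbC` is «`¬ N_W.Prime ∧ ord₃ N_W ≤ 2`» (`exists_isAdmissibleStabData_conductorNorm_iff`).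

References: G. Stevens, *Arithmetic on Modular Curves* (1982) §2.4–2.5 [Stevens1982]; J. Silverman, ATAEC IV.10
[Silverman1994]; J. Silverman, AEC Exercise 8.15 [SilvermanAEC2009].
-/

set_option linter.dupNamespace false
set_option autoImplicit false

noncomputable section

open scoped Classical

open WeierstrassCurve IsDedekindDomain Literature.NumberTheory.EllipticCurves

namespace Summit.BirchSwinnertonDyer.BirchSwinnertonDyer.Theorems.DepletionAtTwo

variable (W : WeierstrassCurve ℚ) [W.IsElliptic] [W.IsGloballyMinimal]

omit [W.IsGloballyMinimal] in
/-- `ord_ℓ N_W ≤ 2` for every prime `ℓ ≥ 5` (the conductor is tame away from `2, 3`; tree theorems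
`factorization_conductorNorm_holds`, `conductorExponent_le_two_of_five_le_natGenerator_holds`; a private copy of eng-2 g6's
`factorization_conductorNorm_le_two_of_five_le` in `…DepletedLawCFLowerHalf.lean`, kept local to avoid that file's imports). [cite: Silverman1994, IV.10.4] -/
private theorem factorization_conductorNorm_le_two_of_five_le_aux {ℓ : ℕ} (hℓ : ℓ.Prime) (h5 : 5 ≤ ℓ) :
    (W.conductorNorm ℤ).factorization ℓ ≤ 2 := by
  set v : HeightOneSpectrum ℤ := (Rat.HeightOneSpectrum.primesEquiv (R := ℤ)).symm ⟨ℓ, hℓ⟩ with hv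
  have hgen : Rat.HeightOneSpectrum.natGenerator v = ℓ :=
    congrArg Subtype.val ((Rat.HeightOneSpectrum.primesEquiv (R := ℤ)).apply_symm_apply ⟨ℓ, hℓ⟩)
  rw [← hgen, W.factorization_conductorNorm_holds v]
  exact W.conductorExponent_le_two_of_five_le_natGenerator_holds v (hgen ▸ h5)

omit [W.IsGloballyMinimal] in
/-- `ord_ℓ N_W = 0` at a prime `ℓ` of good reduction. [cite: Silverman1994, IV.10.2(a)] -/
theorem factorization_conductorNorm_eq_zero_of_hasGoodReductionAtPrime {ℓ : ℕ} [hℓ : Fact ℓ.Prime]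
    (hgood : W.HasGoodReductionAtPrime ℓ) : (W.conductorNorm ℤ).factorization ℓ = 0 := by
  set v : HeightOneSpectrum ℤ := (Rat.HeightOneSpectrum.primesEquiv (R := ℤ)).symm ⟨ℓ, hℓ.out⟩ with hv
  have hgood' : W.HasGoodReductionAt v :=
    (W.hasGoodReductionAtPrime_iff_hasGoodReductionAt_holds ⟨ℓ, hℓ.out⟩).mp hgood
  have hf : W.conductorExponent v = 0 := (WeierstrassCurve.conductorExponent_eq_zero_iff_holds v W).mpr hgood'
  have hgen : Rat.HeightOneSpectrum.natGenerator v = ℓ :=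
    congrArg Subtype.val ((Rat.HeightOneSpectrum.primesEquiv (R := ℤ)).apply_symm_apply ⟨ℓ, hℓ.out⟩)
  rw [← hgen, W.factorization_conductorNorm_holds v, hf]

omit [W.IsGloballyMinimal] in
/-- **Cube-freeness of the conductor of a curve good at `2`, modulo `ord₃ ≤ 2`**: every prime exponent of `N_W` is `≤ 2`
(`ℓ = 2`: exponent `0`; `ℓ = 3`: the hypothesis; `ℓ ≥ 5`: tame). [cite: Silverman1994, IV.10.4] -/
theorem factorization_conductorNorm_le_two (hgood : W.HasGoodReductionAtPrime 2)
    (h3 : (W.conductorNorm ℤ).factorization 3 ≤ 2) :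
    ∀ ℓ ∈ (W.conductorNorm ℤ).primeFactors, (W.conductorNorm ℤ).factorization ℓ ≤ 2 := by
  intro ℓ hℓ
  have hℓp : ℓ.Prime := Nat.prime_of_mem_primeFactors hℓ
  by_cases h2 : ℓ = 2
  · subst h2
    rw [factorization_conductorNorm_eq_zero_of_hasGoodReductionAtPrime W hgood]
    norm_num
  by_cases h3' : ℓ = 3
  · subst h3'; exact h3
  · have h5 : 5 ≤ ℓ := by
      have h2le := hℓp.two_le
      by_contra hlt
      push Not at hlt
      interval_cases ℓ
      · exact h2 rfl
      · exact h3' rfl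
      · exact absurd hℓp (by norm_num)
    exact factorization_conductorNorm_le_two_of_five_le_aux W hℓp h5

/-- **Admissible stabilisation data at the conductor of a habitat-type curve — exactly «not prime ∧ `ord₃ N_W ≤ 2`».**
For a globally minimal elliptic `W/ℚ` with good reduction at `2`: `(∃ β, IsAdmissibleStabData N_W β) ↔ ¬ N_W.Prime ∧ ord₃ N_W ≤ 2`
— `N_W ≠ 0` (`conductorNorm_pos_holds`), `N_W ≠ 1` (Tate, `conductorNorm_ne_one`, PROVED), tameness at `ℓ ≥ 5`, and the
characterisation `exists_isAdmissibleStabData_iff`. The right-hand side is the honest level hypothesis of `stub_starSymbC`.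
[cite: Stevens1982, §2.4–2.5 (PDF pp. 35–38) (admissibility)] [cite: Silverman1994, IV.10.4] [cite: SilvermanAEC2009, Exercise 8.15] -/
theorem exists_isAdmissibleStabData_conductorNorm_iff (hgood : W.HasGoodReductionAtPrime 2) :
    (∃ β : ℕ → ℕ, IsAdmissibleStabData (W.conductorNorm ℤ) β) ↔
      ¬ (W.conductorNorm ℤ).Prime ∧ (W.conductorNorm ℤ).factorization 3 ≤ 2 := by
  rw [exists_isAdmissibleStabData_iff]
  constructor
  · rintro ⟨-, -, hp, hcf⟩
    refine ⟨hp, ?_⟩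
    by_cases h3 : 3 ∈ (W.conductorNorm ℤ).primeFactors
    · exact hcf 3 h3
    · rw [Nat.factorization_eq_zero_of_not_dvd fun h ↦ h3
        (Nat.mem_primeFactors.mpr ⟨Nat.prime_three, h, (W.conductorNorm_pos_holds).ne'⟩)]
      norm_num
  · rintro ⟨hp, h3⟩
    exact ⟨(W.conductorNorm_pos_holds).ne', W.conductorNorm_ne_one, hp, factorization_conductorNorm_le_two W hgood h3⟩

/-- The same for a curve of the Prop-5.14 habitat of line `star` (good ORDINARY at `2`): admissible data at `N_W` exist iff
`N_W` is not prime and `ord₃ N_W ≤ 2`. [cite: Stevens1982, §2.4–2.5 (PDF pp. 35–38) (admissibility)] -/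
theorem exists_isAdmissibleStabData_conductorNorm_iff_of_isOrdinaryAt (hord : IsOrdinaryAt W 2) :
    (∃ β : ℕ → ℕ, IsAdmissibleStabData (W.conductorNorm ℤ) β) ↔
      ¬ (W.conductorNorm ℤ).Prime ∧ (W.conductorNorm ℤ).factorization 3 ≤ 2 :=
  exists_isAdmissibleStabData_conductorNorm_iff W hord.1

end Summit.BirchSwinnertonDyer.BirchSwinnertonDyer.Theorems.DepletionAtTwo

end
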